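import Mathlib
import HarnessLib
import Summits.HubbardSuperconductivity.HubbardSuperconductivity.Theorems.KLProgrammeKLRegimeSplitOnWindow

/-!
# Route `KLProgramme` — GENERIC children of crux K3 `KLRegimeTwoPointLimit` (stmt-HubbardSuperconductivity-19937) over an
# ABSTRACT per-scale predicate bundle, with the glue proved once and for all; instance `klPreds` = today's predicates.  Seat p2.

Why (2026-08-26T09:21:49Z, p1 g5, interface defects in the landed predicate BODIES: p3's `klIsoArray ≡ 0` makes (B3)/(E2′)
content-free; (B2) at Cooper-class tuples needs value-level data — amendments (E2′-v2)/(B1-v2)/(E2-v2) to come, and the tree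
is append-only): the four child STATEMENTS and the glue depend on the predicates only through five slots.  This module makes the
slots explicit — `structure Preds` = {`frameOK`, `renorm`, `split`, `engine`, `twoLeg`} — states the children `EngineP Pr W`,
`BetaSplitP Pr W`, `CountertermP Pr W`, `TwoPointAssemblyP Pr W` for ANY bundle `Pr : Preds` and covariance window `W`
(bodies = `KLProgrammeKLRegimeSplitOnWindow`'s, verbatim, with the predicates abstracted; child 4 Hartree-correct), proves the
glue GENERICALLY (`inductionP`, `k3_inductionP : EngineP Pr klWindowC → BetaSplitP Pr klWindowC → CountertermP Pr klWindowC →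
TwoPointAssemblyP Pr klWindowC → KLRegimeTwoPointLimitMu (-1) (-0.15)`, `k3_twoPointLimit_of_childrenP`), and instantiates
`klPreds : Preds` := today's (`FrameOK`, `RenormalisedAt`, `BetaSplitAt`, `EngineBoundsAt`, `TwoLegStep`), with
`EngineP klPreds W ↔ EngineOn W` etc. by `Iff.rfl`.  A predicate amendment is then ONE new bundle `klPreds₂ : Preds` (plus a
one-line K3-named glue instance downstream), the route's children being re-pointed to `EngineP klPreds₂ klWindowC`, … — no new
child or glue theory.  Constants `G/P/Q/R` (Part 1) stay concrete: they are the staging, not the physics.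

Nothing here asserts anything about the Hubbard model.  References: HOME/planner-g9/SPLIT-ARCH.md R7 (abstract `Preds`); HOME/DECOMP.md v8 §8 (j).
-/

noncomputable section

namespace Summit.HubbardSuperconductivity.HubbardSuperconductivity.Theorems.KLRegimeSplit

set_option linter.dupNamespace false -- summit = problem name (single-conjunct summit), D-0017

open Real Finset Filter Literature.MathematicalPhysics.QuantumLattice Literature.Probability.LatticeModels
open Literature.MathematicalPhysics.QuantumLattice.FermiRG
open Summit.HubbardSuperconductivity.HubbardSuperconductivity.Theorems.KLProgrammeLegKernels
open Summit.HubbardSuperconductivity.HubbardSuperconductivity.Theorems.DispersionFlow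

/-! ## §1 The predicate bundle -/

/-- **The five per-scale predicate slots of the split** (SPLIT-ARCH R7's abstract `Preds`): admissibility of a frame
(`frameOK R U N μ K`), renormalisation of the frame at scale `n` (`renorm L M β U μ K R n`), the Cooper / non-Cooper split of
the running quartic kernel at scale `n` (`split L M G P Q β U μ K n`), the engine's scale-`n` output (`engine L M G P Q β U μ K n`),
the two-leg step at scale `n` (`twoLeg L M G P Q R β U μ K n`).  The instance of record today is `klPreds`. -/
structure Preds where
  /-- admissible frames: `frameOK R U N μ K` -/
  frameOK : RenConsts → ℝ → ℕ → ℝ → TrigPolyC4v → Prop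
  /-- the frame is renormalised down to scale `n`: `renorm L M β U μ K R n` -/
  renorm : (L M : ℕ) → [NeZero L] → [NeZero M] → ℝ → ℝ → ℝ → TrigPolyC4v → RenConsts → ℕ → Prop
  /-- the split at scale `n`: `split L M G P Q β U μ K n` -/
  split : (L M : ℕ) → [NeZero L] → [NeZero M] → GeoConsts → SplitConsts → EngConsts → ℝ → ℝ → ℝ → TrigPolyC4v → ℕ → Prop
  /-- the engine's output at scale `n`: `engine L M G P Q β U μ K n` -/
  engine : (L M : ℕ) → [NeZero L] → [NeZero M] → GeoConsts → SplitConsts → EngConsts → ℝ → ℝ → ℝ → TrigPolyC4v → ℕ → Prop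
  /-- the two-leg step at scale `n`: `twoLeg L M G P Q R β U μ K n` -/
  twoLeg : (L M : ℕ) → [NeZero L] → [NeZero M] → GeoConsts → SplitConsts → EngConsts → RenConsts → ℝ → ℝ → ℝ →
    TrigPolyC4v → ℕ → Prop

/-! ## §2 The history -/

section Model

variable (Pr : Preds) (L M : ℕ) [NeZero L] [NeZero M]

/-- **The history below scale `n`** for the bundle `Pr`: split ∧ renormalisation ∧ engine output ∧ two-leg step at every `j < n`. -/
def HistP (G : GeoConsts) (P : SplitConsts) (Q : EngConsts) (R : RenConsts) (β U μ : ℝ) (K : TrigPolyC4v) (n : ℕ) : Prop :=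
  ∀ j < n, Pr.split L M G P Q β U μ K j ∧ Pr.renorm L M β U μ K R j ∧
    Pr.engine L M G P Q β U μ K j ∧ Pr.twoLeg L M G P Q R β U μ K j

end Model

/-! ## §3 The generic children (predicate bundle `Pr`, covariance window `W`) -/

/-- **Child 3, `EngineP Pr W` (generic; route name `KLRegimeEngine` at a bundle and `W = klWindowC`; rank 2; DECOMP C5b + C4a's two-leg output in the CT
scheme).**  There are absolute constants `G` such that for every choice `P` of the flow's induction constants there are engine
constants `Q` such that for every renormalisation package `R` and every regime constant `c > 0` there are `U₀ > 0` and thresholds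
`L₃ β U`, `M₃ β U L` with: for every covariance potential `μ ∈ W`, `0 < U ≤ U₀`, `klBetaMin ≤ β ≤ e^{c/U²}`, every ADMISSIBLE frame
`K` (`FrameOK`), every `L ≥ L₃ β U`, `M ≥ M₃ β U L` and every scale `n ≤ n_β` in the KL regime: IF the history `Child.Hist n` holds
(split, renormalisation, engine bounds, two-leg step at all `j < n`), THEN `EngineBoundsAt n` and `TwoLegStep n` hold — the
`n!`-free fermionic tree expansion with anisotropic sectors for OUR action, one scale at a time. -/
def EngineP (Pr : Preds) (W : Set ℝ) : Prop :=
  ∃ G : GeoConsts, G.WF ∧ ∀ P : SplitConsts, P.WF → ∃ Q : EngConsts, Q.WF ∧ ∀ R : RenConsts, R.WF → ∀ c : ℝ, 0 < c →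
    ∃ U₀ : ℝ, 0 < U₀ ∧ ∃ L₃ : ℝ → ℝ → ℕ, ∃ M₃ : ℝ → ℝ → ℕ → ℕ,
      ∀ μ ∈ W, ∀ U : ℝ, 0 < U → U ≤ U₀ → ∀ β : ℝ, klBetaMin ≤ β → β ≤ Real.exp (c / U ^ 2) →
        ∀ K : TrigPolyC4v, Pr.frameOK R U (nScales β) μ K →
          ∀ (L M : ℕ) [NeZero L] [NeZero M], L₃ β U ≤ L → M₃ β U L ≤ M →
            ∀ n : ℕ, n ≤ nScales β → IsKLRegime U c (-(n : ℤ)) → HistP Pr L M G P Q R β U μ K n →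
              Pr.engine L M G P Q β U μ K n ∧ Pr.twoLeg L M G P Q R β U μ K n

/-- **Child 1, `BetaSplitP Pr W` (generic; route name `KLRegimeBetaSplit`; rank 3; DECOMP C1 = Lemma E.4 as ONE cascade
step).**  For all absolute constants `G` there are induction constants `P` such that for all engine constants `Q` there is
`c₀ > 0` (no onset: where `β ≤ e^{c/U²}` is spent) such that for every `0 < c ≤ c₀` and every `R` there are `U₀ > 0` and
thresholds `L₁ β U`, `M₁ β U L` with: for every covariance potential `μ ∈ W`, in the regime, for every admissible frame, every
large volume and every scale `n ≤ n_β`: the history below `n` with the engine's scale-`n` output (`EngineBoundsAt n`,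
`TwoLegStep n`) gives the split AT scale `n` (C2's envelopes on (E2); (E2′) + Lemma E.1/E.3's freezing). -/
def BetaSplitP (Pr : Preds) (W : Set ℝ) : Prop :=
  ∀ G : GeoConsts, G.WF → ∃ P : SplitConsts, P.WF ∧ ∀ Q : EngConsts, Q.WF → ∃ c₀ : ℝ, 0 < c₀ ∧
    ∀ c : ℝ, 0 < c → c ≤ c₀ → ∀ R : RenConsts, R.WF →
      ∃ U₀ : ℝ, 0 < U₀ ∧ ∃ L₁ : ℝ → ℝ → ℕ, ∃ M₁ : ℝ → ℝ → ℕ → ℕ,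
        ∀ μ ∈ W, ∀ U : ℝ, 0 < U → U ≤ U₀ → ∀ β : ℝ, klBetaMin ≤ β → β ≤ Real.exp (c / U ^ 2) →
          ∀ K : TrigPolyC4v, Pr.frameOK R U (nScales β) μ K →
            ∀ (L M : ℕ) [NeZero L] [NeZero M], L₁ β U ≤ L → M₁ β U L ≤ M →
              ∀ n : ℕ, n ≤ nScales β → IsKLRegime U c (-(n : ℤ)) → HistP Pr L M G P Q R β U μ K n →
                Pr.engine L M G P Q β U μ K n → Pr.twoLeg L M G P Q R β U μ K n →
                  Pr.split L M G P Q β U μ K n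

/-- **Child 2, `CountertermP Pr W` (generic; route name `KLRegimeCounterterm`; rank 4; DECOMP C4 in the counterterm scheme
= FST's inversion by successive approximation), VOLUME-UNIFORM.**  For all `G, P, Q` there are a renormalisation package `R` and
`c₁ > 0` such that for every `0 < c ≤ c₁` there is `U₀ > 0` with: at every covariance potential `μ ∈ W` and regime point `(U, β)`
and for ANY thresholds `(Lh, Mh)`: IF for every admissible frame `K` and every `L ≥ Lh`, `M ≥ Mh L` the frame's renormalisation
below `n` yields the engine's output, the two-leg step and the split at `n` (all `n ≤ n_β`), THEN there is ONE admissible frame `K`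
(chosen BEFORE the volume) with thresholds `(Lc, Mc)` such that `K` is renormalised down to every scale `n ≤ n_β` at every
`L ≥ Lc`, `M ≥ Mc L` (self-map of the frame ball from the sizes + tangential floor of (E3); contraction from `FrameLipschitz`;
finite-volume / Matsubara corrections inside the tolerances). -/
def CountertermP (Pr : Preds) (W : Set ℝ) : Prop :=
  ∀ G : GeoConsts, ∀ P : SplitConsts, ∀ Q : EngConsts, G.WF → P.WF → Q.WF →
    ∃ R : RenConsts, R.WF ∧ ∃ c₁ : ℝ, 0 < c₁ ∧ ∀ c : ℝ, 0 < c → c ≤ c₁ → ∃ U₀ : ℝ, 0 < U₀ ∧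
      ∀ μ ∈ W, ∀ U : ℝ, 0 < U → U ≤ U₀ → ∀ β : ℝ, klBetaMin ≤ β → β ≤ Real.exp (c / U ^ 2) →
        ∀ (Lh : ℕ) (Mh : ℕ → ℕ),
          (∀ K : TrigPolyC4v, Pr.frameOK R U (nScales β) μ K →
            ∀ (L M : ℕ) [NeZero L] [NeZero M], Lh ≤ L → Mh L ≤ M →
              ∀ n : ℕ, n ≤ nScales β → (∀ j < n, Pr.renorm L M β U μ K R j) →
                Pr.engine L M G P Q β U μ K n ∧ Pr.twoLeg L M G P Q R β U μ K n ∧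
                  Pr.split L M G P Q β U μ K n) →
          ∃ K : TrigPolyC4v, Pr.frameOK R U (nScales β) μ K ∧ ∃ (Lc : ℕ) (Mc : ℕ → ℕ),
            ∀ (L M : ℕ) [NeZero L] [NeZero M], Lc ≤ L → Mc L ≤ M →
              ∀ n : ℕ, n ≤ nScales β → Pr.renorm L M β U μ K R n

/-- **Child 4, `TwoPointAssemblyP Pr W` (generic; route name `KLRegimeTwoPointAssembly`; rank 5; BGM 2006 §2.4 /
Lemmas 2.4–2.5 role), HARTREE-CORRECT.**  For all constants and every `c > 0` there is `U₀ > 0` with: at every covariance potential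
`μ ∈ W` and regime point `(U, β)`, IF there is ONE admissible frame `K` renormalised, split, engine-bounded and two-leg-controlled at
every scale `n ≤ n_β` for all `L ≥ L⋆`, `M ≥ M⋆ L` (all at the COVARIANCE potential `μ` of the Grassmann carrier), THEN the
finite-volume equal-time thermal two-point functions of the Hubbard torus at the PHYSICAL potential `μ + U/2` converge as `L → ∞`
(one scale decomposition in a fixed frame: termwise volume limits + uniform tails; `M → ∞` first —
`tendsto_grassmannTwoPoint_eq_hubbardThermalTwoPoint_sub` carries the shift `μ ↦ μ + U/2`). -/
def TwoPointAssemblyP (Pr : Preds) (W : Set ℝ) : Prop :=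
  ∀ G : GeoConsts, ∀ P : SplitConsts, ∀ Q : EngConsts, ∀ R : RenConsts, G.WF → P.WF → Q.WF → R.WF →
    ∀ c : ℝ, 0 < c → ∃ U₀ : ℝ, 0 < U₀ ∧
      ∀ μ ∈ W, ∀ U : ℝ, 0 < U → U ≤ U₀ → ∀ β : ℝ, klBetaMin ≤ β → β ≤ Real.exp (c / U ^ 2) →
        ∀ (Lstar : ℕ) (Mstar : ℕ → ℕ),
          (∃ K : TrigPolyC4v, Pr.frameOK R U (nScales β) μ K ∧
            ∀ (L M : ℕ) [NeZero L] [NeZero M], Lstar ≤ L → Mstar L ≤ M → ∀ n : ℕ, n ≤ nScales β →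
              Pr.renorm L M β U μ K R n ∧ Pr.split L M G P Q β U μ K n ∧
                Pr.engine L M G P Q β U μ K n ∧ Pr.twoLeg L M G P Q R β U μ K n) →
          ∀ (x y : Site 2) (σ σ' : Fin 2), ∃ S : ℂ,
            Tendsto (fun L : ℕ => hubbardThermalTwoPoint β U (μ + U / 2) L x y σ σ') atTop (nhds S)

/-! ## §4 The generic glue -/

/-- **GLUE for a covariance window `W` receiving `μ - U/2`**: if every physical `μ ∈ [-1, -0.15]` and `0 < U ≤ 1/10` has
`μ - U/2 ∈ W`, the four children on `W` give K3 on the analysis window `KLRegimeTwoPointLimitMu (-1) (-0.15)` (= the registered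
stub `KLRegimeAnalysisWindow`).  Order of choices: `G` (child 3) → `P` (child 1) → `Q` (child 3) → `c₀` (child 1), `(R, c₁)`
(child 2) → `c = min c₀ c₁` → the four `U₀`'s, `a / log 128` and `1/10` → per `(μ, U, β)` at the covariance potential
`μ - U/2`: the hypothesis thresholds of children 3 + 1 maxed, the strong induction `Child.allScales` for every admissible frame,
child 2's volume-uniform frame with its thresholds, child 4 beyond the max of all thresholds — whose conclusion at
`(μ - U/2) + U/2 = μ` is K3's. -/
theorem inductionP {Pr : Preds} {W : Set ℝ}
    (hW : ∀ μ ∈ Set.Icc (-1 : ℝ) (-0.15), ∀ U : ℝ, 0 < U → U ≤ 1 / 10 → μ - U / 2 ∈ W)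
    (h₃ : EngineP Pr W) (h₁ : BetaSplitP Pr W) (h₂ : CountertermP Pr W) (h₄ : TwoPointAssemblyP Pr W) :
    KLRegimeTwoPointLimitMu (-1) (-0.15) := by
  intro a ha
  obtain ⟨G, hG, h₃P⟩ := h₃
  obtain ⟨P, hP, h₁Q⟩ := h₁ G hG
  obtain ⟨Q, hQ, h₃R⟩ := h₃P P hP
  obtain ⟨c₀, hc₀, h₁c⟩ := h₁Q Q hQ
  obtain ⟨R, hR, c₁, hc₁, h₂c⟩ := h₂ G P Q hG hP hQ
  set c : ℝ := min c₀ c₁ with hc_def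
  have hc : 0 < c := lt_min hc₀ hc₁
  obtain ⟨U₃, hU₃, L₃, M₃, h₃main⟩ := h₃R R hR c hc
  obtain ⟨U₁, hU₁, L₁, M₁, h₁main⟩ := h₁c c hc (min_le_left _ _) R hR
  obtain ⟨U₂, hU₂, h₂main⟩ := h₂c c hc (min_le_right _ _)
  obtain ⟨U₄, hU₄, h₄main⟩ := h₄ G P Q R hG hP hQ hR c hc
  have hlog : 0 < Real.log klBetaMin := Real.log_pos (by norm_num [klBetaMin])
  set U₀ : ℝ := min (min (min (min U₁ U₂) (min U₃ U₄)) (a / Real.log klBetaMin)) (1 / 10) with hU₀_def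
  have hU₀ : 0 < U₀ :=
    lt_min (lt_min (lt_min (lt_min hU₁ hU₂) (lt_min hU₃ hU₄)) (div_pos ha hlog)) (by norm_num)
  refine ⟨U₀, c, hU₀, hc, ?_⟩
  intro μ hμ U β hU hUle hβa hβc x y σ σ'
  have hU5 : U ≤ min (min (min U₁ U₂) (min U₃ U₄)) (a / Real.log klBetaMin) := hUle.trans (min_le_left _ _)
  have hU10 : U ≤ 1 / 10 := hUle.trans (min_le_right _ _)
  have hU1 : U ≤ U₁ := hU5.trans ((min_le_left _ _).trans ((min_le_left _ _).trans (min_le_left _ _)))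
  have hU2 : U ≤ U₂ := hU5.trans ((min_le_left _ _).trans ((min_le_left _ _).trans (min_le_right _ _)))
  have hU3 : U ≤ U₃ := hU5.trans ((min_le_left _ _).trans ((min_le_right _ _).trans (min_le_left _ _)))
  have hU4 : U ≤ U₄ := hU5.trans ((min_le_left _ _).trans ((min_le_right _ _).trans (min_le_right _ _)))
  have hβmin : klBetaMin ≤ β := klBetaMin_le_of_exp_le hU hU5 (min_le_right _ _) hβa
  have hβpos : 0 < β := pos_of_klBetaMin_le hβmin
  have hKL : ∀ n ≤ nScales β, IsKLRegime U c (-(n : ℤ)) := fun n hn =>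
    isKLRegime_of_le_tempScaleIdx hc.le hβpos hβc hn
  -- the covariance potential
  set ν : ℝ := μ - U / 2 with hν_def
  have hν : ν ∈ W := hW μ hμ U hU hU10
  -- the glued induction (children 3 + 1) for EVERY admissible frame, beyond the maxed hypothesis thresholds
  have hall : ∀ K : TrigPolyC4v, Pr.frameOK R U (nScales β) ν K →
      ∀ (L M : ℕ) [NeZero L] [NeZero M], max (L₃ β U) (L₁ β U) ≤ L → max (M₃ β U L) (M₁ β U L) ≤ M →
        ∀ n : ℕ, n ≤ nScales β → (∀ j < n, Pr.renorm L M β U ν K R j) →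
          Pr.engine L M G P Q β U ν K n ∧ Pr.twoLeg L M G P Q R β U ν K n ∧
            Pr.split L M G P Q β U ν K n := by
    intro K hK L M _ _ hL hM n hn hRn
    have hL3 : L₃ β U ≤ L := (le_max_left _ _).trans hL
    have hL1 : L₁ β U ≤ L := (le_max_right _ _).trans hL
    have hM3 : M₃ β U L ≤ M := (le_max_left _ _).trans hM
    have hM1 : M₁ β U L ≤ M := (le_max_right _ _).trans hM
    exact Child.allScales (N := nScales β) (KL := fun n => IsKLRegime U c (-(n : ℤ)))
      (B := fun n => Pr.split L M G P Q β U ν K n) (Rn := fun n => Pr.renorm L M β U ν K R n)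
      (E := fun n => Pr.engine L M G P Q β U ν K n) (T := fun n => Pr.twoLeg L M G P Q R β U ν K n)
      (fun n hn hkl hyp => h₃main ν hν U hU hU3 β hβmin hβc K hK L M hL3 hM3 n hn hkl hyp)
      (fun n hn hkl hyp hEn hTn => h₁main ν hν U hU hU1 β hβmin hβc K hK L M hL1 hM1 n hn hkl hyp hEn hTn)
      hKL n hn hRn
  -- child 2: the volume-uniform renormalised admissible frame and its thresholds
  obtain ⟨K, hK, Lc, Mc, hKR⟩ :=
    h₂main ν hν U hU hU2 β hβmin hβc (max (L₃ β U) (L₁ β U)) (fun L => max (M₃ β U L) (M₁ β U L)) hall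
  -- child 4 at the covariance potential, beyond every threshold; its conclusion is at ν + U/2 = μ
  have hphys : ν + U / 2 = μ := by rw [hν_def]; ring
  have h4 := h₄main ν hν U hU hU4 β hβmin hβc (max Lc (max (L₃ β U) (L₁ β U)))
    (fun L => max (Mc L) (max (M₃ β U L) (M₁ β U L))) ⟨K, hK, ?_⟩ x y σ σ'
  · rwa [hphys] at h4
  intro L M _ _ hL hM n hn
  have hLc : Lc ≤ L := (le_max_left _ _).trans hL
  have hLh : max (L₃ β U) (L₁ β U) ≤ L := (le_max_right _ _).trans hL
  have hMc : Mc L ≤ M := (le_max_left _ _).trans hM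
  have hMh : max (M₃ β U L) (M₁ β U L) ≤ M := (le_max_right _ _).trans hM
  have h := hall K hK L M hLh hMh n hn fun j hj => hKR L M hLc hMc j (le_of_lt (lt_of_lt_of_le hj hn))
  exact ⟨hKR L M hLc hMc n hn, h.2.2, h.1, h.2.1⟩

/-- **GLUE for the filed children**: the four children on the covariance window `klWindowC` give K3 on the analysis window
(`KLRegimeAnalysisWindow`; K3 itself follows with S0 — `k3_twoPointLimit_of_children`, and BY NAME downstream in
`KLProgrammeKLRegimeSplitGlue.lean`). -/
theorem k3_inductionP {Pr : Preds} (h₃ : EngineP Pr klWindowC) (h₁ : BetaSplitP Pr klWindowC)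
    (h₂ : CountertermP Pr klWindowC) (h₄ : TwoPointAssemblyP Pr klWindowC) : KLRegimeTwoPointLimitMu (-1) (-0.15) :=
  inductionP (fun _ hμ _ hU hU' => sub_half_mem_klWindowC hμ hU hU') h₃ h₁ h₂ h₄

/-- **The crux modulo S0, from the filed children**: with `μ(δ) ∈ [-1, -0.15]` for `δ ∈ [0.10, 0.35]` (S0 `MuOfDopingWindow`,
stated structurally to keep this module free of the route file) the four children give `KLRegimeTwoPointLimit`'s body. -/
theorem k3_twoPointLimit_of_childrenP {Pr : Preds} (h₃ : EngineP Pr klWindowC) (h₁ : BetaSplitP Pr klWindowC)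
    (h₂ : CountertermP Pr klWindowC) (h₄ : TwoPointAssemblyP Pr klWindowC)
    (hS0 : ∀ δ ∈ Set.Icc (0.10 : ℝ) 0.35,
      chemicalPotentialOfDensity (squareDispersion 1 0) (1 - δ) ∈ Set.Icc (-1 : ℝ) (-0.15)) :
    ∀ a : ℝ, 0 < a → ∃ U₀ c : ℝ, 0 < U₀ ∧ 0 < c ∧ ∀ δ ∈ Set.Icc (0.10 : ℝ) 0.35, ∀ U β : ℝ, 0 < U → U ≤ U₀ →
      Real.exp (a / U) ≤ β → β ≤ Real.exp (c / U ^ 2) → ∀ (x y : Site 2) (σ σ' : Fin 2), ∃ S : ℂ,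
        Tendsto (fun L : ℕ => hubbardThermalTwoPoint β U
          (chemicalPotentialOfDensity (squareDispersion 1 0) (1 - δ)) L x y σ σ') atTop (nhds S) := by
  intro a ha
  obtain ⟨U₀, c, hU₀, hc, H⟩ := k3_inductionP h₃ h₁ h₂ h₄ a ha
  exact ⟨U₀, c, hU₀, hc, fun δ hδ U β hU hUle hβ hβ' x y σ σ' => H _ (hS0 δ hδ) U β hU hUle hβ hβ' x y σ σ'⟩


/-! ## §5 The instance of record today -/

/-- **`klPreds`** — today's predicates in the five slots: `FrameOK`, `RenormalisedAt` (Part 1), `BetaSplitAt`, `EngineBoundsAt`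
(Part 2), `TwoLegStep` (Part 2 v2).  The FILED children are `EngineP klPreds klWindowC`, … (equal to `EngineOn klWindowC`, … by
`Iff.rfl`); a predicate amendment lands as a new bundle next to this one. -/
def klPreds : Preds where
  frameOK := FrameOK
  renorm := fun L M _ _ β U μ K R n => RenormalisedAt L M β U μ K R n
  split := fun L M _ _ G P Q β U μ K n => BetaSplitAt L M G P Q β U μ K n
  engine := fun L M _ _ G P Q β U μ K n => EngineBoundsAt L M G P Q β U μ K n
  twoLeg := fun L M _ _ G P Q R β U μ K n => TwoLegStep L M G P Q R β U μ K n

/-- The generic engine child at `klPreds` is `EngineOn`. -/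
theorem engineP_klPreds (W : Set ℝ) : EngineP klPreds W ↔ EngineOn W := Iff.rfl

/-- The generic flow child at `klPreds` is `BetaSplitOn`. -/
theorem betaSplitP_klPreds (W : Set ℝ) : BetaSplitP klPreds W ↔ BetaSplitOn W := Iff.rfl

/-- The generic counterterm child at `klPreds` is `CountertermOn`. -/
theorem countertermP_klPreds (W : Set ℝ) : CountertermP klPreds W ↔ CountertermOn W := Iff.rfl

/-- The generic assembly child at `klPreds` is `TwoPointAssemblyOn`. -/
theorem twoPointAssemblyP_klPreds (W : Set ℝ) : TwoPointAssemblyP klPreds W ↔ TwoPointAssemblyOn W := Iff.rfl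

end Summit.HubbardSuperconductivity.HubbardSuperconductivity.Theorems.KLRegimeSplit

end
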